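import Literature.NumberTheory.Transcendental.RoyCriterionProofs
import HarnessLib

/-!
# Roy 2001, Theorem 3 (Waldschmidt's auxiliary polynomial): refutation of the printed statement,
# corrected statement, and its proof

Topic: `Literature/NumberTheory/Transcendental`. Companion of `RoyCriterionProofs.lean`, which
vendors **Theorem 3** of [Roy2001] (p. 190: "the following special case of Theorem 3.1 of
[Waldschmidt1981]") verbatim as the named fact `Roy2001_thm3`:

> Let `Δ, r, T₀, T₁, U` be positive numbers. Assume `U ≥ 3`,
> `log((T₀+1)(T₁+1)) + Δ + T₀ log(er) + erT₁ ≤ U` and `(8U)² ≤ ΔT₀T₁`. Then there exists a nonzero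
> polynomial `P ∈ ℤ[X₀, X₁]` with partial degree `≤ T₀` in `X₀`, partial degree `≤ T₁` in `X₁` and
> height `≤ e^Δ` such that the function `f(z) = P(z, e^z)` satisfies `|f|_r ≤ e^{-U}`.

## What the source of the source prints (GDZ scan of Invent. Math. 63, p. 101)

**Théorème 3.1** [Waldschmidt1981]. "Soient `L` et `n` deux entiers positifs, `S, U, R, r` des
nombres réels positifs, et `φ₁, …, φ_L` des fonctions continues sur `B(0, R)`, analytiques à
l'intérieur. On suppose `3 ≤ U`, `S ≤ U`, `e ≤ R/r ≤ e^U`, `∑_{λ=1}^{L} |φ_λ|_R ≤ e^U`, et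
`(8U)^{n+1} ≤ L S (Log(R/r))ⁿ`. Alors il existe des entiers rationnels `p₁, …, p_L`, avec
`0 < max |p_λ| ≤ e^S`, tels que la fonction `F = ∑ p_λ φ_λ` vérifie `|F|_r ≤ e^{-U}`."
Its proof (§3 b)–d), pp. 102–104; there `T₀` denotes `4U/log(R/r) ∈ [4, 4U]`, not a degree):
Lemme 3.3 (a Siegel lemma by the box principle, after "lemme 1 de [Mignotte–Waldschmidt]") applied
to the `< (T₀+1)ⁿ` Taylor-coefficient forms `p ↦ ∑_λ p_λ D^τφ_λ(0) r^{|τ|}/τ!` (`|τ| < T = ⌈T₀⌉`),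
each made `≤ ½(1+T₀)^{-n} e^{-U}`, and Lemme 3.4 (Schwarz lemma on `F -` Taylor polynomial,
Parseval) for the remainder `(1 + √T)(r/R)^T |F|_R ≤ ½ e^{3U} (R/r)^{-T₀} = ½ e^{-U}`.

Roy's Theorem 3 is the case `n = 1`, `φ_{(a,b)}(z) = z^a e^{bz}` (`0 ≤ a ≤ T₀`, `0 ≤ b ≤ T₁`),
`L = (⌊T₀⌋+1)(⌊T₁⌋+1)`, `S = Δ`, `R = e r`: then `log(R/r) = 1`, `(8U)² ≤ ΔT₀T₁ ≤ LS`, and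
`∑ |φ_λ|_R ≤ (T₀+1)(T₁+1) (er)^{T₀} e^{erT₁}`, `S = Δ ≤ U` both follow from Roy's displayed
condition — **provided `e r ≥ 1`** (so that `(er)^a ≤ (er)^{T₀}` and `T₀ log(er) ≥ 0`). This
proviso is implicit in print (Roy applies Theorem 3 with `r = N^{s₁+ε}` in Prop. 2 and
`r = 1 + cN^{s₁}` in §5, both `≥ 1`), and without it the statement is false.

## Content

* `Roy2001_thm3_false : ¬ Roy2001_thm3` — the verbatim statement fails at `Δ = 2304`,
  `r = e^{-10000}`, `T₀ = T₁ = ½`, `U = 3` (then `P` must be a non-zero constant).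
* `Roy2001_thm3'` — the corrected statement: Roy's Theorem 3 with the hypothesis `e⁻¹ ≤ r` made
  explicit (replacing `0 < r`); docstring records the discrepancy. PROVED: `Roy2001_thm3'_holds`.
* The proof is Waldschmidt's, specialised to `φ_{(p,q)} = z^p e^{qz}` and written with generous
  constants (for `n = 1` the count below needs only `12U² + 30U + 18 ≤ 64U²`, true for `U ≥ 3`):
  `exists_ne_zero_int_forms_le` (the box principle for real linear forms = Lemme 3.3 over `ℝ`),
  `expMonoCoeff` / `sum_range_expMonoCoeff` / `norm_pow_mul_exp_tail_le` (Taylor head and tail of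
  `z^p e^{qz}`; since all Taylor coefficients are `≥ 0`, the tail is dominated termwise by
  `e^{-n} (er)^p e^{qer}` and no Schwarz lemma / Lemme 3.4 is needed),
  `norm_expEval_polyOfCoeffs_le_forms` (head + tail estimate), and the parameter choice
  `X = ⌊e^Δ⌋`, `K = ⌈2U⌉ + 2` forms, `ℓ = ⌈2K e^{2U}⌉` subdivisions, with the count
  `ℓ^K < (X+1)^L ⇐ K(2U + log(2K+1)) < 12U² + 30U + 18 ≤ 64U² ≤ ΔT₀T₁ ≤ ΔL`.
* `royHypothesis_exp_of_thm3'` — Roy 2001, §5, 2° run from the corrected Theorem 3 (the radius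
  there is `r = 1 + cN^{s₁} ≥ 1 ≥ e⁻¹`); with `Roy2001_thm3'_holds` this re-proves
  `royHypothesis_exp'` along the printed route. (`RoyCriterionProofs.lean` already proves §5
  unconditionally through `exists_royAuxPoly`; `Roy2001_iff_holds` is in
  `RoyCriterionProp3Proofs.lean`. Nothing in the tree depends on `Roy2001_thm3`.)

## Sources

* D. Roy, *An arithmetic criterion for the values of the exponential function*, Acta Arith. 97
  (2001), 183–194, Thm. 3 (p. 190), Prop. 2 (p. 191), §5 (pp. 193–194). [Roy2001]
* M. Waldschmidt, *Transcendance et exponentielles en plusieurs variables*, Invent. Math. 63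
  (1981), 97–127, §3: Théorème 3.1 (p. 101), Lemmes 3.3–3.4 (p. 102), proof (pp. 103–104);
  read on the GDZ scan `PPN356556735_0063/LOG_0012`. [Waldschmidt1981]

## Not here

Théorème 3.1 in its printed generality (`n` variables, arbitrary `φ_λ`, complex coefficients and
Lemme 3.4) — only the special case Roy uses; and no edit of `RoyCriterionProofs.lean` (the false
fact `Roy2001_thm3` keeps its name and statement; this file is where its status is recorded).
-/

noncomputable section

open MvPolynomial Filter Complex Metric Finset

namespace Literature.NumberTheory.Transcendental

/-! ### The printed statement is false -/
/-- **The printed statement is false** (so the named fact `Roy2001_thm3`, which transcribes it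
verbatim, can never be discharged): `Δ = 2304`, `r = e^{-10000}`, `T₀ = T₁ = ½`, `U = 3` satisfy
every hypothesis of Roy 2001, Thm. 3 as printed (`log 2.25 + 2304 + ½·(1 - 10⁴) + ½e^{1-10⁴} ≤ 3`,
`(8·3)² = 576 = 2304 · ¼`), but a non-zero `P ∈ ℤ[X₀, X₁]` of partial degrees `≤ ½` is a non-zero
constant `c`, and `|c| ≥ 1 > e^{-3}`. The missing hypothesis is `e r ≥ 1` (see `Roy2001_thm3'`).
[cite: Roy2001, Thm. 3 (p. 190)] -/
theorem Roy2001_thm3_false : ¬ Roy2001_thm3 := by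
  intro h
  have hr : (0 : ℝ) < Real.exp (-10000) := Real.exp_pos _
  have hlog : Real.log (Real.exp 1 * Real.exp (-10000)) = -9999 := by
    rw [← Real.exp_add, Real.log_exp]; norm_num
  have hsmall : Real.exp 1 * Real.exp (-10000) ≤ 1 := by
    rw [← Real.exp_add, ← Real.exp_zero]
    exact Real.exp_le_exp.2 (by norm_num)
  have hlog2 : Real.log ((1 / 2 + 1) * (1 / 2 + 1)) ≤ (1 / 2 + 1) * (1 / 2 + 1) - 1 :=
    Real.log_le_sub_one_of_pos (by norm_num)
  obtain ⟨P, hP0, hd0, hd1, -, hval⟩ := h 2304 (Real.exp (-10000)) (1 / 2) (1 / 2) 3 (by norm_num)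
    hr (by norm_num) (by norm_num) le_rfl (by rw [hlog]; nlinarith [hsmall, hlog2]) (by norm_num)
  -- `P` is a non-zero constant
  have hdeg : ∀ i : Fin 2, P.degreeOf i = 0 := by
    intro i
    have key : ∀ j : Fin 2, j = 0 ∨ j = 1 := by decide
    have : (P.degreeOf i : ℝ) < 1 := by
      rcases key i with rfl | rfl <;> linarith
    exact Nat.lt_one_iff.mp (by exact_mod_cast this)
  have hm0 : ∀ m ∈ P.support, m = 0 := by
    intro m hm
    ext i
    have := (degreeOf_le_iff.1 (hdeg i).le) m hm
    simpa using this
  have htot : P.totalDegree = 0 := by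
    refine Nat.le_zero.1 (Finset.sup_le fun m hm => ?_)
    rw [hm0 m hm]; simp
  rw [totalDegree_eq_zero_iff_eq_C] at htot
  have hc : P.coeff 0 ≠ 0 := by
    intro h0; apply hP0; rw [htot, h0, C_0]
  have h1 : (1 : ℝ) ≤ ‖aeval ![(0 : ℂ), cexp 0] P‖ := by
    rw [htot, aeval_C, algebraMap_int_eq, eq_intCast, Complex.norm_intCast]
    exact_mod_cast Int.one_le_abs hc
  have h2 := hval 0 (by simpa using hr.le)
  have h3 : Real.exp (-3) < 1 := by
    rw [← Real.exp_zero]; exact Real.exp_lt_exp.2 (by norm_num)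
  linarith

/-! ### Lemme 3.3 over `ℝ`: the box principle for real linear forms -/

/-- **Box principle for real linear forms** (the Thue–Siegel–Mignotte–Waldschmidt lemma behind
Waldschmidt 1981, Lemme 3.3; real-coefficient version): given real coefficients `u k i`
(`k ∈ κ` forms, `i ∈ ι` unknowns) and natural numbers `X`, `ℓ ≥ 1` with `ℓ^{#κ} < (X+1)^{#ι}`,
there is `t ∈ ℤ^ι ∖ {0}` with `|t i| ≤ X` and `|∑ᵢ u k i · t i| ≤ X (∑ᵢ |u k i|) / ℓ` for every `k`.
(Proof: the `(X+1)^{#ι}` points `ξ ∈ {0,…,X}^ι` are sorted into `ℓ^{#κ}` boxes according to the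
position of each form in its range, an interval of length `X ∑ᵢ |u k i|` cut into `ℓ` pieces.)
[cite: Waldschmidt1981, §3 b) Lemme 3.3 (p. 102)] -/
theorem exists_ne_zero_int_forms_le {ι κ : Type*} [Fintype ι] [Fintype κ] [DecidableEq ι]
    (u : κ → ι → ℝ) (X ℓ : ℕ) (hℓ : 0 < ℓ)
    (hcard : ℓ ^ Fintype.card κ < (X + 1) ^ Fintype.card ι) :
    ∃ t : ι → ℤ, t ≠ 0 ∧ (∀ i, |t i| ≤ X) ∧
      ∀ k, |∑ i, u k i * t i| ≤ (X : ℝ) * (∑ i, |u k i|) / ℓ := by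
  classical
  -- the forms on the points `ξ ∈ {0, …, X}^ι`, shifted to be non-negative
  set v : κ → (ι → Fin (X + 1)) → ℝ := fun k ξ => ∑ i, u k i * ((ξ i : ℕ) : ℝ) with hv
  set lo : κ → ℝ := fun k => ∑ i, min (u k i) 0 * X with hlo
  set A : κ → ℝ := fun k => ∑ i, |u k i| with hA
  set w : κ → ℝ := fun k => X * A k / ℓ with hw
  have hℓr : (0 : ℝ) < ℓ := by exact_mod_cast hℓ
  have hℓw : ∀ k, (ℓ : ℝ) * w k = X * A k := by
    intro k; rw [hw]; field_simp
  have hξX : ∀ (ξ : ι → Fin (X + 1)) (i : ι), ((ξ i : ℕ) : ℝ) ≤ X := fun ξ i => by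
    exact_mod_cast Nat.lt_succ_iff.1 (ξ i).isLt
  -- `0 ≤ v k ξ - lo k ≤ X * A k`
  have hrange : ∀ k ξ, 0 ≤ v k ξ - lo k ∧ v k ξ - lo k ≤ X * A k := by
    intro k ξ
    have h1 : v k ξ - lo k = ∑ i, (u k i * ((ξ i : ℕ) : ℝ) - min (u k i) 0 * X) := by
      rw [hv, hlo]; simp [Finset.sum_sub_distrib]
    have h2 : X * A k = ∑ i, (X : ℝ) * |u k i| := by rw [hA, Finset.mul_sum]
    rw [h1, h2]
    constructor
    · refine Finset.sum_nonneg fun i _ => ?_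
      have hξ0 : (0 : ℝ) ≤ ((ξ i : ℕ) : ℝ) := Nat.cast_nonneg _
      rcases le_total (u k i) 0 with hu | hu
      · rw [min_eq_left hu]; nlinarith [hξX ξ i]
      · rw [min_eq_right hu]; nlinarith
    · refine Finset.sum_le_sum fun i _ => ?_
      have hξ0 : (0 : ℝ) ≤ ((ξ i : ℕ) : ℝ) := Nat.cast_nonneg _
      rcases le_total (u k i) 0 with hu | hu
      · rw [min_eq_left hu, abs_of_nonpos hu]; nlinarith [hξX ξ i]
      · rw [min_eq_right hu, abs_of_nonneg hu]; nlinarith [hξX ξ i]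
  -- the box of a point
  have hℓ1 : ℓ - 1 < ℓ := Nat.sub_lt hℓ one_pos
  set c : (ι → Fin (X + 1)) → κ → Fin ℓ := fun ξ k =>
    ⟨min ⌊(v k ξ - lo k) / w k⌋₊ (ℓ - 1), lt_of_le_of_lt (min_le_right _ _) hℓ1⟩ with hc
  have hcard' : Fintype.card (κ → Fin ℓ) < Fintype.card (ι → Fin (X + 1)) := by
    simpa [Fintype.card_fun, Fintype.card_fin] using hcard
  obtain ⟨ξ, ξ', hne, heq⟩ := Fintype.exists_ne_map_eq_of_card_lt c hcard'
  -- two points in the same box: each form differs by at most `w k`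
  have hclose : ∀ k, |v k ξ - v k ξ'| ≤ w k := by
    intro k
    have hk : c ξ k = c ξ' k := by rw [heq]
    simp only [hc, Fin.mk.injEq] at hk
    obtain ⟨h0, h1⟩ := hrange k ξ
    obtain ⟨h0', h1'⟩ := hrange k ξ'
    rcases eq_or_lt_of_le (show 0 ≤ w k from by rw [hw]; positivity) with hw0 | hw0
    · -- `w k = 0`: then `X * A k = 0` and both shifted values vanish
      have hXA : (X : ℝ) * A k = 0 := by rw [← hℓw, ← hw0, mul_zero]
      rw [← hw0]
      have : v k ξ - v k ξ' = (v k ξ - lo k) - (v k ξ' - lo k) := by ring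
      rw [this, abs_le]; constructor <;> linarith
    · -- `w k > 0`: both values lie in `[m w, (m + 1) w]` for the common box index `m`
      have key : ∀ y : ℝ, 0 ≤ y → y ≤ X * A k →
          (min ⌊y / w k⌋₊ (ℓ - 1) : ℕ) * w k ≤ y ∧ y ≤ ((min ⌊y / w k⌋₊ (ℓ - 1) : ℕ) + 1) * w k := by
        intro y hy0 hy1
        have hyw : 0 ≤ y / w k := div_nonneg hy0 hw0.le
        constructor
        · calc ((min ⌊y / w k⌋₊ (ℓ - 1) : ℕ) : ℝ) * w k ≤ (⌊y / w k⌋₊ : ℝ) * w k := by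
                gcongr; exact min_le_left _ _
            _ ≤ (y / w k) * w k := by gcongr; exact Nat.floor_le hyw
            _ = y := div_mul_cancel₀ _ hw0.ne'
        · rcases le_or_gt ⌊y / w k⌋₊ (ℓ - 1) with hcase | hcase
          · rw [min_eq_left hcase]
            have := Nat.lt_floor_add_one (y / w k)
            have : y / w k * w k ≤ ((⌊y / w k⌋₊ : ℝ) + 1) * w k := by gcongr
            rwa [div_mul_cancel₀ _ hw0.ne'] at this
          · rw [min_eq_right hcase.le]
            have : ((ℓ - 1 : ℕ) : ℝ) + 1 = ℓ := by
              rw [Nat.cast_sub hℓ]; push_cast; ring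
            rw [this, hℓw]; exact hy1
      obtain ⟨ha, hb⟩ := key _ h0 h1
      obtain ⟨ha', hb'⟩ := key _ h0' h1'
      rw [hk] at ha hb
      have : v k ξ - v k ξ' = (v k ξ - lo k) - (v k ξ' - lo k) := by ring
      rw [this, abs_le]; constructor <;> nlinarith
  -- the difference of the two points
  refine ⟨fun i => ((ξ i : ℕ) : ℤ) - ((ξ' i : ℕ) : ℤ), ?_, ?_, ?_⟩
  · intro h0
    apply hne
    funext i
    have := congrFun h0 i
    simp only [Pi.zero_apply, sub_eq_zero, Nat.cast_inj] at this
    exact Fin.ext this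
  · intro i
    show |((ξ i : ℕ) : ℤ) - ((ξ' i : ℕ) : ℤ)| ≤ X
    rw [abs_le]
    have h1' : ((ξ i : ℕ) : ℤ) ≤ X := by exact_mod_cast Nat.lt_succ_iff.1 (ξ i).isLt
    have h2' : ((ξ' i : ℕ) : ℤ) ≤ X := by exact_mod_cast Nat.lt_succ_iff.1 (ξ' i).isLt
    constructor <;> omega
  · intro k
    have : ∑ i, u k i * (((((ξ i : ℕ) : ℤ) - ((ξ' i : ℕ) : ℤ) : ℤ)) : ℝ) = v k ξ - v k ξ' := by
      rw [hv]; simp only [Int.cast_sub, Int.cast_natCast, mul_sub, Finset.sum_sub_distrib]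
    rw [this]
    exact (hclose k).trans (le_of_eq (by rw [hw]))


/-! ### Taylor head and tail of `z^p e^{qz}` -/

/-- The Taylor coefficients at `0` of `z^p e^{qz} = ∑ₙ c_{p,q}(n) zⁿ`: `c_{p,q}(n) = q^{n-p}/(n-p)!`
for `n ≥ p` and `0` otherwise (Waldschmidt's `D^τφ_λ(0)/τ!` for `φ_λ = z^p e^{qz}`).
[cite: Waldschmidt1981, §3 d) (p. 103)] -/
def expMonoCoeff (p q n : ℕ) : ℝ :=
  if p ≤ n then (q : ℝ) ^ (n - p) / (n - p).factorial else 0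

/-- `c_{p,q}(n) ≥ 0`. [cite: Waldschmidt1981, §3 d) (p. 103)] -/
theorem expMonoCoeff_nonneg (p q n : ℕ) : 0 ≤ expMonoCoeff p q n := by
  unfold expMonoCoeff; split_ifs <;> positivity

/-- The head of the Taylor series of `z^p e^{qz}`: `∑_{n<K} c_{p,q}(n) zⁿ = z^p ∑_{m<K-p} (qz)^m/m!`.
[cite: Waldschmidt1981, §3 c) (p. 102)] -/
theorem sum_range_expMonoCoeff (p q K : ℕ) (z : ℂ) :
    ∑ n ∈ Finset.range K, (expMonoCoeff p q n : ℂ) * z ^ n =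
      z ^ p * ∑ m ∈ Finset.range (K - p), ((q : ℂ) * z) ^ m / (m.factorial : ℂ) := by
  induction K with
  | zero => simp
  | succ K ih =>
    rw [Finset.sum_range_succ, ih]
    by_cases hp : p ≤ K
    · have hK : K + 1 - p = (K - p) + 1 := by omega
      rw [hK, Finset.sum_range_succ, mul_add]
      congr 1
      unfold expMonoCoeff
      rw [if_pos hp]
      push_cast
      have : z ^ K = z ^ p * z ^ (K - p) := by rw [← pow_add]; congr 1; omega
      rw [this, mul_pow]; ring
    · push Not at hp
      have h1 : K + 1 - p = 0 := by omega
      have h2 : K - p = 0 := by omega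
      rw [h1, h2]
      unfold expMonoCoeff
      rw [if_neg (by omega)]
      simp

/-- `c_{p,q}(n) rⁿ ≤ r^p e^{qr}` (one term of the series of `r^p e^{qr}`).
[cite: Waldschmidt1981, §3 d) (p. 104, first display)] -/
theorem expMonoCoeff_mul_pow_le (p q n : ℕ) {r : ℝ} (hr : 0 ≤ r) :
    expMonoCoeff p q n * r ^ n ≤ r ^ p * Real.exp (q * r) := by
  unfold expMonoCoeff
  split_ifs with h
  · have key : (q * r) ^ (n - p) / (n - p).factorial ≤ Real.exp (q * r) :=
      Real.pow_div_factorial_le_exp (q * r) (by positivity) _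
    calc (q : ℝ) ^ (n - p) / (n - p).factorial * r ^ n
        = r ^ p * ((q * r) ^ (n - p) / (n - p).factorial) := by
          have : r ^ n = r ^ p * r ^ (n - p) := by rw [← pow_add]; congr 1; omega
          rw [this, mul_pow]; ring
      _ ≤ r ^ p * Real.exp (q * r) := by gcongr
  · rw [zero_mul]; positivity

/-- The termwise estimate `r^p (qr)ⁿ/n! ≤ e^{-(n+p)} · (er)^p e^{q e r}` (passage from the radius
`r` to `R = e r`). [cite: Waldschmidt1981, §3 d) (p. 104)] -/
theorem pow_mul_pow_div_factorial_le (p q n : ℕ) {r : ℝ} (hr : 0 ≤ r) :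
    r ^ p * ((q * r) ^ n / n.factorial) ≤
      Real.exp (-((n : ℝ) + p)) * ((Real.exp 1 * r) ^ p * Real.exp (q * (Real.exp 1 * r))) := by
  have hE := Real.exp_pos 1
  have key : (q * (Real.exp 1 * r)) ^ n / n.factorial ≤ Real.exp (q * (Real.exp 1 * r)) :=
    Real.pow_div_factorial_le_exp (q * (Real.exp 1 * r)) (by positivity) n
  have hexp : Real.exp (-((n : ℝ) + p)) * Real.exp 1 ^ (n + p) = 1 := by
    rw [← Real.exp_nat_mul, ← Real.exp_add]
    push_cast; ring_nf; exact Real.exp_zero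
  calc r ^ p * ((q * r) ^ n / n.factorial)
      = Real.exp (-((n : ℝ) + p)) *
          ((Real.exp 1 * r) ^ p * ((q * (Real.exp 1 * r)) ^ n / n.factorial)) := by
        rw [show (Real.exp 1 * r) ^ p * ((q * (Real.exp 1 * r)) ^ n / n.factorial) =
          Real.exp 1 ^ (n + p) * (r ^ p * ((q * r) ^ n / n.factorial)) by rw [pow_add]; ring]
        rw [← mul_assoc, hexp, one_mul]
    _ ≤ Real.exp (-((n : ℝ) + p)) * ((Real.exp 1 * r) ^ p * Real.exp (q * (Real.exp 1 * r))) := by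
        gcongr

/-- The tail of the Taylor series of `z^p e^{qz}` beyond the order `M + p`, on `|z| ≤ r`:
`|z^p (e^{qz} - ∑_{m<M} (qz)^m/m!)| ≤ (er)^p e^{qer} e^{-(M+p)} / (1 - e^{-1})`.
[cite: Waldschmidt1981, §3 c)–d) (pp. 102–104)] -/
theorem norm_pow_mul_exp_tail_le (p q M : ℕ) {r : ℝ} {z : ℂ} (hz : ‖z‖ ≤ r) :
    ‖z ^ p * (cexp ((q : ℂ) * z) - ∑ m ∈ Finset.range M, ((q : ℂ) * z) ^ m / (m.factorial : ℂ))‖ ≤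
      (Real.exp 1 * r) ^ p * Real.exp (q * (Real.exp 1 * r)) * Real.exp (-((M + p : ℕ) : ℝ)) /
        (1 - Real.exp (-1)) := by
  have hr : 0 ≤ r := (norm_nonneg z).trans hz
  set w : ℂ := (q : ℂ) * z with hw_def
  set C : ℝ := (Real.exp 1 * r) ^ p * Real.exp (q * (Real.exp 1 * r)) with hC
  have h1 : HasSum (fun m => w ^ m / (m.factorial : ℂ)) (cexp w) := by
    rw [congrFun Complex.exp_eq_exp_ℂ w]
    exact NormedSpace.expSeries_div_hasSum_exp w
  have h2 := (hasSum_nat_add_iff' M).mpr h1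
  have h3 := h2.mul_left (z ^ p)
  have he : Real.exp (-1) < 1 := Real.exp_lt_one_iff.2 (by norm_num)
  have he0 : 0 ≤ Real.exp (-1) := (Real.exp_pos _).le
  have hg : HasSum (fun m : ℕ => C * Real.exp (-((M + p : ℕ) : ℝ)) * Real.exp (-1) ^ m)
      (C * Real.exp (-((M + p : ℕ) : ℝ)) * (1 - Real.exp (-1))⁻¹) :=
    (hasSum_geometric_of_lt_one he0 he).mul_left _
  rw [div_eq_mul_inv]
  refine h3.norm_le_of_bounded hg fun m => ?_
  rw [norm_mul, norm_div, norm_pow, norm_pow, hw_def, norm_mul, Complex.norm_natCast,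
    Complex.norm_natCast]
  calc ‖z‖ ^ p * ((q * ‖z‖) ^ (m + M) / ((m + M).factorial : ℝ))
      ≤ r ^ p * ((q * r) ^ (m + M) / ((m + M).factorial : ℝ)) := by gcongr
    _ ≤ Real.exp (-(((m + M : ℕ) : ℝ) + p)) * C := pow_mul_pow_div_factorial_le p q (m + M) hr
    _ = C * Real.exp (-((M + p : ℕ) : ℝ)) * Real.exp (-1) ^ m := by
        rw [← Real.exp_nat_mul, mul_assoc, ← Real.exp_add, mul_comm]
        push_cast; ring_nf


/-! ### The corrected statement and its proof -/

/-- **Roy 2001, Theorem 3 — corrected statement.** Roy's Theorem 3 (p. 190) is "the special case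
of Theorem 3.1 of [Waldschmidt 1981]" with `n = 1`, `φ_{(a,b)}(z) = z^a e^{bz}` (`0 ≤ a ≤ T₀`,
`0 ≤ b ≤ T₁`), `L = (⌊T₀⌋+1)(⌊T₁⌋+1)`, `S = Δ` and `R = e r` (so that `log(R/r) = 1`); the two
hypotheses `S ≤ U` and `∑_λ |φ_λ|_R ≤ (T₀+1)(T₁+1)(er)^{T₀} e^{erT₁} ≤ e^U` of Theorem 3.1 follow
from Roy's displayed condition only when `e r ≥ 1`, which is implicit in print (both applications
in Roy 2001, Prop. 2 and §5, have `r ≥ 1`) and without which the printed statement is false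
(`Roy2001_thm3_false`). This is the printed statement with that hypothesis made explicit:
let `Δ, T₀, T₁ > 0`, `r ≥ e⁻¹`, `U ≥ 3` with `log((T₀+1)(T₁+1)) + Δ + T₀ log(er) + erT₁ ≤ U` and
`(8U)² ≤ ΔT₀T₁`; then there is a non-zero `P ∈ ℤ[X₀, X₁]` of partial degrees `≤ T₀`, `≤ T₁`, height
`≤ e^Δ`, with `|P(z, e^z)| ≤ e^{-U}` for `|z| ≤ r`.
[cite: Roy2001, Thm. 3 (p. 190); Waldschmidt1981, §3 Théorème 3.1 (p. 101)] -/
def Roy2001_thm3' : Prop :=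
  ∀ (Δ r T₀ T₁ U : ℝ), 0 < Δ → Real.exp (-1) ≤ r → 0 < T₀ → 0 < T₁ → 3 ≤ U →
    Real.log ((T₀ + 1) * (T₁ + 1)) + Δ + T₀ * Real.log (Real.exp 1 * r) + Real.exp 1 * r * T₁ ≤ U →
    (8 * U) ^ 2 ≤ Δ * T₀ * T₁ →
    ∃ P : MvPolynomial (Fin 2) ℤ, P ≠ 0 ∧ (P.degreeOf 0 : ℝ) ≤ T₀ ∧ (P.degreeOf 1 : ℝ) ≤ T₁ ∧
      (mvPolyHeight P : ℝ) ≤ Real.exp Δ ∧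
      ∀ z : ℂ, ‖z‖ ≤ r → ‖aeval ![z, cexp z] P‖ ≤ Real.exp (-U)

/-- `z^p (e^z)^q = (head of order K) + (tail)`: the splitting of `φ_{(p,q)}(z) = z^p e^{qz}` used in
the proof of Theorem 3.1. [cite: Waldschmidt1981, §3 c) Lemme 3.4 (p. 102)] -/
theorem pow_mul_exp_pow_eq_head_add_tail (p q K : ℕ) (z : ℂ) :
    z ^ p * cexp z ^ q =
      (∑ n ∈ Finset.range K, (expMonoCoeff p q n : ℂ) * z ^ n) +
        z ^ p * (cexp ((q : ℂ) * z) -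
          ∑ m ∈ Finset.range (K - p), ((q : ℂ) * z) ^ m / (m.factorial : ℂ)) := by
  rw [sum_range_expMonoCoeff, ← Complex.exp_nat_mul]; ring

/-- **The analytic estimate of the proof of Theorem 3.1** for `F(z) = ∑ t_{p,q} z^p e^{qz}`
(`0 ≤ p ≤ a`, `0 ≤ q ≤ b`, `|t_{p,q}| ≤ X`) on `|z| ≤ r`: if the `K` Taylor-coefficient forms
`∑_{p,q} c_{p,q}(n) rⁿ t_{p,q}` (`n < K`) are bounded by `B` in absolute value, then
`|F(z)| ≤ K B + X · e^{-K}/(1 - e^{-1}) · ∑_{p,q} (er)^p e^{q e r}` (head: the small forms; tail: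
termwise domination of the Taylor series of `z^p e^{qz}` by `e^{-n} (er)^p e^{qer}`, which is
Waldschmidt's passage from `r` to `R = e r`; it replaces Lemme 3.4 since here all Taylor
coefficients are `≥ 0`). [cite: Waldschmidt1981, §3 c)–d) (pp. 102–104)] -/
theorem norm_expEval_polyOfCoeffs_le_forms {a b : ℕ} (K : ℕ) (t : Fin (a + 1) × Fin (b + 1) → ℤ)
    {r X B : ℝ} (hr : 0 < r) (htX : ∀ i, |(t i : ℝ)| ≤ X)
    (hforms : ∀ n, n < K → |∑ i, expMonoCoeff i.1 i.2 n * r ^ n * (t i : ℝ)| ≤ B)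
    {z : ℂ} (hz : ‖z‖ ≤ r) :
    ‖expEval (polyOfCoeffs t) z‖ ≤
      K * B + X * (Real.exp (-(K : ℝ)) / (1 - Real.exp (-1))) *
        ∑ i : Fin (a + 1) × Fin (b + 1),
          (Real.exp 1 * r) ^ (i.1 : ℕ) * Real.exp ((i.2 : ℕ) * (Real.exp 1 * r)) := by
  have hz0 : 0 ≤ ‖z‖ := norm_nonneg z
  have hX0 : 0 ≤ X := (abs_nonneg _).trans (htX ⟨0, 0⟩)
  have he1 : 0 < 1 - Real.exp (-1) := by
    have := Real.exp_lt_one_iff.2 (show (-1 : ℝ) < 0 by norm_num); linarith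
  -- split `F(z)` into head and tail
  set head : ℂ := ∑ n ∈ Finset.range K,
    (∑ i, (t i : ℂ) * (expMonoCoeff i.1 i.2 n : ℂ)) * z ^ n with hhead
  set tail : ℂ := ∑ i : Fin (a + 1) × Fin (b + 1), (t i : ℂ) * (z ^ (i.1 : ℕ) *
    (cexp (((i.2 : ℕ) : ℂ) * z) -
      ∑ m ∈ Finset.range (K - i.1), (((i.2 : ℕ) : ℂ) * z) ^ m / (m.factorial : ℂ))) with htail
  have hsplit : expEval (polyOfCoeffs t) z = head + tail := by
    rw [expEval_polyOfCoeffs]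
    simp_rw [pow_mul_exp_pow_eq_head_add_tail _ _ K z, mul_add, Finset.sum_add_distrib]
    congr 1
    rw [hhead]
    simp_rw [Finset.mul_sum, ← mul_assoc]
    rw [Finset.sum_comm]
    simp_rw [← Finset.sum_mul]
  -- the head: the `K` small forms
  have hform : ∀ n, n < K →
      ‖(∑ i, (t i : ℂ) * (expMonoCoeff i.1 i.2 n : ℂ)) * z ^ n‖ ≤ B := by
    intro n hn
    rw [norm_mul, norm_pow]
    have hcast : (∑ i, (t i : ℂ) * (expMonoCoeff i.1 i.2 n : ℂ)) =
        ((∑ i, (t i : ℝ) * expMonoCoeff i.1 i.2 n : ℝ) : ℂ) := by push_cast; rfl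
    rw [hcast, Complex.norm_real, Real.norm_eq_abs]
    calc |∑ i, (t i : ℝ) * expMonoCoeff i.1 i.2 n| * ‖z‖ ^ n
        ≤ |∑ i, (t i : ℝ) * expMonoCoeff i.1 i.2 n| * r ^ n := by gcongr
      _ = |∑ i, expMonoCoeff i.1 i.2 n * r ^ n * (t i : ℝ)| := by
          rw [show (∑ i, expMonoCoeff i.1 i.2 n * r ^ n * (t i : ℝ)) =
              (∑ i, (t i : ℝ) * expMonoCoeff i.1 i.2 n) * r ^ n by
            rw [Finset.sum_mul]; exact Finset.sum_congr rfl fun i _ => by ring]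
          rw [abs_mul, abs_of_nonneg (pow_nonneg hr.le n)]
      _ ≤ B := hforms n hn
  have hhead_le : ‖head‖ ≤ K * B :=
    calc ‖head‖ ≤ ∑ n ∈ Finset.range K, ‖(∑ i, (t i : ℂ) * (expMonoCoeff i.1 i.2 n : ℂ)) * z ^ n‖ :=
          norm_sum_le _ _
      _ ≤ ∑ _n ∈ Finset.range K, B := Finset.sum_le_sum fun n hn => hform n (Finset.mem_range.1 hn)
      _ = K * B := by simp
  -- the tail
  have hterm : ∀ i : Fin (a + 1) × Fin (b + 1), ‖(t i : ℂ) * (z ^ (i.1 : ℕ) *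
      (cexp (((i.2 : ℕ) : ℂ) * z) -
        ∑ m ∈ Finset.range (K - i.1), (((i.2 : ℕ) : ℂ) * z) ^ m / (m.factorial : ℂ)))‖ ≤
      X * (Real.exp (-(K : ℝ)) / (1 - Real.exp (-1))) *
        ((Real.exp 1 * r) ^ (i.1 : ℕ) * Real.exp ((i.2 : ℕ) * (Real.exp 1 * r))) := by
    intro i
    rw [norm_mul, Complex.norm_intCast]
    have h2 := norm_pow_mul_exp_tail_le (i.1 : ℕ) (i.2 : ℕ) (K - i.1) hz
    have h3 : Real.exp (-((K - (i.1 : ℕ) + (i.1 : ℕ) : ℕ) : ℝ)) ≤ Real.exp (-(K : ℝ)) := by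
      apply Real.exp_le_exp.2
      have : K ≤ K - (i.1 : ℕ) + (i.1 : ℕ) := le_tsub_add
      have : (K : ℝ) ≤ ((K - (i.1 : ℕ) + (i.1 : ℕ) : ℕ) : ℝ) := by exact_mod_cast this
      linarith
    have hC0 : 0 ≤ (Real.exp 1 * r) ^ (i.1 : ℕ) * Real.exp ((i.2 : ℕ) * (Real.exp 1 * r)) := by
      positivity
    calc |(t i : ℝ)| * ‖z ^ (i.1 : ℕ) * (cexp (((i.2 : ℕ) : ℂ) * z) -
          ∑ m ∈ Finset.range (K - i.1), (((i.2 : ℕ) : ℂ) * z) ^ m / (m.factorial : ℂ))‖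
        ≤ X * ((Real.exp 1 * r) ^ (i.1 : ℕ) * Real.exp ((i.2 : ℕ) * (Real.exp 1 * r)) *
            Real.exp (-((K - (i.1 : ℕ) + (i.1 : ℕ) : ℕ) : ℝ)) / (1 - Real.exp (-1))) :=
          mul_le_mul (htX i) h2 (norm_nonneg _) hX0
      _ ≤ X * ((Real.exp 1 * r) ^ (i.1 : ℕ) * Real.exp ((i.2 : ℕ) * (Real.exp 1 * r)) *
            Real.exp (-(K : ℝ)) / (1 - Real.exp (-1))) := by
          refine mul_le_mul_of_nonneg_left ?_ hX0
          exact div_le_div_of_nonneg_right (mul_le_mul_of_nonneg_left h3 hC0) he1.le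
      _ = X * (Real.exp (-(K : ℝ)) / (1 - Real.exp (-1))) *
            ((Real.exp 1 * r) ^ (i.1 : ℕ) * Real.exp ((i.2 : ℕ) * (Real.exp 1 * r))) := by ring
  have htail_le : ‖tail‖ ≤ X * (Real.exp (-(K : ℝ)) / (1 - Real.exp (-1))) *
      ∑ i : Fin (a + 1) × Fin (b + 1),
        (Real.exp 1 * r) ^ (i.1 : ℕ) * Real.exp ((i.2 : ℕ) * (Real.exp 1 * r)) :=
    calc ‖tail‖ ≤ ∑ i, ‖(t i : ℂ) * (z ^ (i.1 : ℕ) * (cexp (((i.2 : ℕ) : ℂ) * z) -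
          ∑ m ∈ Finset.range (K - i.1), (((i.2 : ℕ) : ℂ) * z) ^ m / (m.factorial : ℂ)))‖ :=
        norm_sum_le _ _
      _ ≤ ∑ i : Fin (a + 1) × Fin (b + 1), X * (Real.exp (-(K : ℝ)) / (1 - Real.exp (-1))) *
          ((Real.exp 1 * r) ^ (i.1 : ℕ) * Real.exp ((i.2 : ℕ) * (Real.exp 1 * r))) :=
        Finset.sum_le_sum fun i _ => hterm i
      _ = _ := by rw [← Finset.mul_sum]
  calc ‖expEval (polyOfCoeffs t) z‖ = ‖head + tail‖ := by rw [hsplit]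
    _ ≤ ‖head‖ + ‖tail‖ := norm_add_le _ _
    _ ≤ _ := add_le_add hhead_le htail_le

/-- The numerical fact `e^{-U-2}/(1 - e^{-1}) ≤ ½ e^{-U}` (i.e. `2 + e ≤ e²`) closing the
tail estimate. [cite: Waldschmidt1981, §3 d) (p. 104)] -/
theorem exp_neg_sub_two_div_le (U : ℝ) :
    Real.exp (-U - 2) / (1 - Real.exp (-1)) ≤ Real.exp (-U) / 2 := by
  have he1 : 0 < 1 - Real.exp (-1) := by
    have := Real.exp_lt_one_iff.2 (show (-1 : ℝ) < 0 by norm_num); linarith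
  have hsq : Real.exp (-U - 2) = Real.exp (-U) * (Real.exp (-1) * Real.exp (-1)) := by
    rw [← Real.exp_add, ← Real.exp_add]; ring_nf
  have hinv : Real.exp (-1) * Real.exp 1 = 1 := by
    rw [← Real.exp_add]; norm_num
  have hem : 0 < Real.exp (-1) := Real.exp_pos _
  have hU' : 0 < Real.exp (-U) := Real.exp_pos _
  have he2 : (2 : ℝ) ≤ Real.exp 1 := by
    have := Real.add_one_le_exp (1 : ℝ); norm_num at this ⊢; linarith
  -- `e ≥ 2` gives `e^{-1} ≤ ½`, hence `2 e^{-2} ≤ e^{-1} ≤ 1 - e^{-1}`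
  have hx : Real.exp (-1) ≤ 1 / 2 := by nlinarith
  have key : Real.exp (-1) * Real.exp (-1) * 2 ≤ 1 - Real.exp (-1) := by
    nlinarith [mul_pos hem hem]
  rw [hsq, div_le_div_iff₀ he1 two_pos]
  nlinarith

/-- **Roy 2001, Theorem 3 (corrected) holds** — Waldschmidt's construction (Invent. Math. 63,
§3 d), pp. 103–104) specialised to `φ_{(p,q)} = z^p e^{qz}`, `R = e r`: with `X = ⌊e^Δ⌋`,
`K = ⌈2U⌉ + 2` and `ℓ = ⌈2K e^{2U}⌉`, the box principle (`exists_ne_zero_int_forms_le`, the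
real form of Lemme 3.3) applied to the `K` Taylor-coefficient forms
`t ↦ ∑_{(p,q)} c_{p,q}(n) rⁿ t_{p,q}` (`n < K`; each has `∑ |coeff| ≤ e^{U-Δ}`) yields
`t ∈ ℤ^L ∖ 0`, `|t| ≤ X`, making each form `≤ e^U/ℓ ≤ e^{-U}/(2K)`; the count
`ℓ^K < (X+1)^L` is `K(2U + log(2K+1)) < 12U² + 30U + 18 ≤ 64U² ≤ ΔT₀T₁ ≤ ΔL`. Then
`norm_expEval_polyOfCoeffs_le_forms` gives `|P(z,e^z)| ≤ ½e^{-U} + e^{U-K}/(1-e^{-1}) ≤ e^{-U}` on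
`|z| ≤ r`. [cite: Roy2001, Thm. 3 (p. 190); Waldschmidt1981, §3 Théorème 3.1 (pp. 101–104)] -/
theorem Roy2001_thm3'_holds : Roy2001_thm3' := by
  intro Δ r T₀ T₁ U hΔ hr hT₀ hT₁ hU h1 h2
  -- positivity bookkeeping
  have hE : 0 < Real.exp 1 := Real.exp_pos 1
  have hEr : 1 ≤ Real.exp 1 * r := by
    have := mul_le_mul_of_nonneg_left hr hE.le
    rwa [← Real.exp_add, add_neg_cancel, Real.exp_zero] at this
  have hr0 : 0 < r := lt_of_lt_of_le (Real.exp_pos _) hr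
  have hrE : r ≤ Real.exp 1 * r := by
    have : (1 : ℝ) ≤ Real.exp 1 := by
      have := Real.add_one_le_exp (1 : ℝ); linarith
    nlinarith
  have hU0 : 0 < U := by linarith
  -- the integers `a = ⌊T₀⌋`, `b = ⌊T₁⌋`, `X = ⌊e^Δ⌋`, `K = ⌈2U⌉ + 2`, `ℓ = ⌈2K e^{2U}⌉`
  obtain ⟨a, haT, hTa⟩ : ∃ a : ℕ, (a : ℝ) ≤ T₀ ∧ T₀ < a + 1 :=
    ⟨⌊T₀⌋₊, Nat.floor_le hT₀.le, Nat.lt_floor_add_one T₀⟩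
  obtain ⟨b, hbT, hTb⟩ : ∃ b : ℕ, (b : ℝ) ≤ T₁ ∧ T₁ < b + 1 :=
    ⟨⌊T₁⌋₊, Nat.floor_le hT₁.le, Nat.lt_floor_add_one T₁⟩
  obtain ⟨X, hXle, hXlt⟩ : ∃ X : ℕ, (X : ℝ) ≤ Real.exp Δ ∧ Real.exp Δ < X + 1 :=
    ⟨⌊Real.exp Δ⌋₊, Nat.floor_le (Real.exp_pos Δ).le, Nat.lt_floor_add_one _⟩
  obtain ⟨K, hK1, hK2⟩ : ∃ K : ℕ, 2 * U + 2 ≤ K ∧ (K : ℝ) < 2 * U + 3 := by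
    refine ⟨⌈2 * U⌉₊ + 2, ?_, ?_⟩
    · push_cast; linarith [Nat.le_ceil (2 * U)]
    · push_cast; linarith [Nat.ceil_lt_add_one (show 0 ≤ 2 * U by positivity)]
  have hKpos : (0 : ℝ) < K := by linarith
  obtain ⟨ℓ, hℓ1, hℓ2⟩ : ∃ ℓ : ℕ, 2 * K * Real.exp (2 * U) ≤ ℓ ∧
      (ℓ : ℝ) < 2 * K * Real.exp (2 * U) + 1 :=
    ⟨⌈2 * K * Real.exp (2 * U)⌉₊, Nat.le_ceil _, Nat.ceil_lt_add_one (by positivity)⟩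
  have hℓposR : (0 : ℝ) < ℓ := lt_of_lt_of_le (by positivity) hℓ1
  have hℓpos : 0 < ℓ := by exact_mod_cast hℓposR
  -- `C_{p,q} = (er)^p e^{q e r}` and `∑ C ≤ e^{U - Δ}`
  have hCsum : ∑ i : Fin (a + 1) × Fin (b + 1),
      (Real.exp 1 * r) ^ (i.1 : ℕ) * Real.exp ((i.2 : ℕ) * (Real.exp 1 * r)) ≤ Real.exp (U - Δ) := by
    have hi : ∀ i : Fin (a + 1) × Fin (b + 1),
        (Real.exp 1 * r) ^ (i.1 : ℕ) * Real.exp ((i.2 : ℕ) * (Real.exp 1 * r)) ≤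
          (Real.exp 1 * r) ^ T₀ * Real.exp (Real.exp 1 * r * T₁) := by
      intro i
      have hp : ((i.1 : ℕ) : ℝ) ≤ T₀ :=
        le_trans (by exact_mod_cast Nat.lt_succ_iff.1 i.1.isLt) haT
      have hq : ((i.2 : ℕ) : ℝ) ≤ T₁ :=
        le_trans (by exact_mod_cast Nat.lt_succ_iff.1 i.2.isLt) hbT
      have e1 : (Real.exp 1 * r) ^ (i.1 : ℕ) ≤ (Real.exp 1 * r) ^ T₀ := by
        rw [← Real.rpow_natCast]
        exact Real.rpow_le_rpow_of_exponent_le hEr hp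
      have e2 : Real.exp ((i.2 : ℕ) * (Real.exp 1 * r)) ≤ Real.exp (Real.exp 1 * r * T₁) := by
        apply Real.exp_le_exp.2
        have : 0 ≤ Real.exp 1 * r := by positivity
        nlinarith
      exact mul_le_mul e1 e2 (Real.exp_pos _).le (by positivity)
    calc ∑ i : Fin (a + 1) × Fin (b + 1),
          (Real.exp 1 * r) ^ (i.1 : ℕ) * Real.exp ((i.2 : ℕ) * (Real.exp 1 * r))
        ≤ ∑ _i : Fin (a + 1) × Fin (b + 1), (Real.exp 1 * r) ^ T₀ * Real.exp (Real.exp 1 * r * T₁) :=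
          Finset.sum_le_sum fun i _ => hi i
      _ = ((a : ℝ) + 1) * ((b : ℝ) + 1) * ((Real.exp 1 * r) ^ T₀ * Real.exp (Real.exp 1 * r * T₁)) := by
          rw [Finset.sum_const, Finset.card_univ, nsmul_eq_mul]
          simp [Fintype.card_prod, Fintype.card_fin]
      _ ≤ (T₀ + 1) * (T₁ + 1) * ((Real.exp 1 * r) ^ T₀ * Real.exp (Real.exp 1 * r * T₁)) := by
          gcongr
      _ = Real.exp (Real.log ((T₀ + 1) * (T₁ + 1)) + T₀ * Real.log (Real.exp 1 * r) +
            Real.exp 1 * r * T₁) := by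
          rw [Real.exp_add, Real.exp_add, Real.exp_log (by positivity),
            Real.rpow_def_of_pos (by positivity), mul_comm (Real.log _) T₀]; ring
      _ ≤ Real.exp (U - Δ) := Real.exp_le_exp.2 (by linarith)
  -- the linear forms `u n (p,q) = c_{p,q}(n) rⁿ`; `∑_{p,q} |u n (p,q)| ≤ e^{U-Δ}`
  set u : Fin K → Fin (a + 1) × Fin (b + 1) → ℝ := fun n i =>
    expMonoCoeff i.1 i.2 n * r ^ (n : ℕ) with hu
  have hA : ∀ n, ∑ i, |u n i| ≤ Real.exp (U - Δ) := by
    intro n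
    calc ∑ i, |u n i| = ∑ i, u n i := Finset.sum_congr rfl fun i _ =>
          abs_of_nonneg (mul_nonneg (expMonoCoeff_nonneg _ _ _) (pow_nonneg hr0.le _))
      _ ≤ ∑ i : Fin (a + 1) × Fin (b + 1),
          (Real.exp 1 * r) ^ (i.1 : ℕ) * Real.exp ((i.2 : ℕ) * (Real.exp 1 * r)) := by
          refine Finset.sum_le_sum fun i _ => ?_
          calc u n i ≤ r ^ (i.1 : ℕ) * Real.exp ((i.2 : ℕ) * r) :=
                expMonoCoeff_mul_pow_le _ _ _ hr0.le
            _ ≤ (Real.exp 1 * r) ^ (i.1 : ℕ) * Real.exp ((i.2 : ℕ) * (Real.exp 1 * r)) := by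
                gcongr
      _ ≤ Real.exp (U - Δ) := hCsum
  -- the count `ℓ^K < (X+1)^L`
  have hcount : ℓ ^ Fintype.card (Fin K) < (X + 1) ^ Fintype.card (Fin (a + 1) × Fin (b + 1)) := by
    simp only [Fintype.card_fin, Fintype.card_prod]
    have hL : Δ * T₀ * T₁ ≤ Δ * (((a + 1) * (b + 1) : ℕ) : ℝ) := by
      push_cast
      have := mul_le_mul hTa.le hTb.le hT₁.le (by positivity)
      nlinarith
    have hnum : (K : ℝ) * (2 * K + 2 * U) < Δ * (((a + 1) * (b + 1) : ℕ) : ℝ) := by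
      have s1 : (K : ℝ) * (2 * K + 2 * U) < (2 * U + 3) * (6 * U + 6) := by nlinarith
      have s2 : (2 * U + 3) * (6 * U + 6) ≤ (8 * U) ^ 2 := by nlinarith
      linarith
    have hreal : ((ℓ : ℕ) : ℝ) ^ K < (((X + 1 : ℕ)) : ℝ) ^ ((a + 1) * (b + 1)) := by
      have hℓ3 : (ℓ : ℝ) ≤ (2 * K + 1) * Real.exp (2 * U) := by
        have : (1 : ℝ) ≤ Real.exp (2 * U) := Real.one_le_exp (by positivity)
        nlinarith
      have hlog : Real.log (2 * K + 1) ≤ 2 * K := by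
        have := Real.log_le_sub_one_of_pos (show (0 : ℝ) < 2 * K + 1 by positivity); linarith
      calc ((ℓ : ℕ) : ℝ) ^ K ≤ ((2 * K + 1) * Real.exp (2 * U)) ^ K := by gcongr
        _ = Real.exp (K * (Real.log (2 * K + 1) + 2 * U)) := by
            rw [Real.exp_nat_mul, Real.exp_add, Real.exp_log (by positivity)]
        _ ≤ Real.exp (K * (2 * K + 2 * U)) := by
            apply Real.exp_le_exp.2; gcongr
        _ < Real.exp (Δ * (((a + 1) * (b + 1) : ℕ) : ℝ)) := Real.exp_lt_exp.2 hnum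
        _ = Real.exp Δ ^ ((a + 1) * (b + 1)) := by
            rw [← Real.exp_nat_mul, mul_comm]
        _ ≤ (((X + 1 : ℕ)) : ℝ) ^ ((a + 1) * (b + 1)) := by
            push_cast
            gcongr
    exact_mod_cast hreal
  -- the box principle
  obtain ⟨t, ht0, htX, hforms⟩ := exists_ne_zero_int_forms_le u X ℓ hℓpos hcount
  have htX' : ∀ i, |(t i : ℝ)| ≤ X := fun i => by
    rw [← Int.cast_abs]; exact_mod_cast htX i
  refine ⟨polyOfCoeffs t, polyOfCoeffs_ne_zero ht0, ?_, ?_, ?_, ?_⟩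
  · calc ((polyOfCoeffs t).degreeOf 0 : ℝ) ≤ a := by exact_mod_cast degreeOf_polyOfCoeffs_fst t
      _ ≤ T₀ := haT
  · calc ((polyOfCoeffs t).degreeOf 1 : ℝ) ≤ b := by exact_mod_cast degreeOf_polyOfCoeffs_snd t
      _ ≤ T₁ := hbT
  · have htnorm : ‖t‖ ≤ X := by
      refine (pi_norm_le_iff_of_nonneg (by positivity)).2 fun i => ?_
      rw [Int.norm_eq_abs]
      exact htX' i
    exact (mvPolyHeight_polyOfCoeffs_le t).trans (htnorm.trans hXle)
  · intro z hz
    -- the forms are `≤ e^U / ℓ`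
    have hB : ∀ n, n < K → |∑ i, expMonoCoeff i.1 i.2 n * r ^ n * (t i : ℝ)| ≤ Real.exp U / ℓ := by
      intro n hn
      calc |∑ i, expMonoCoeff i.1 i.2 n * r ^ n * (t i : ℝ)| = |∑ i, u ⟨n, hn⟩ i * t i| := rfl
        _ ≤ (X : ℝ) * (∑ i, |u ⟨n, hn⟩ i|) / ℓ := hforms ⟨n, hn⟩
        _ ≤ (X : ℝ) * Real.exp (U - Δ) / ℓ := by gcongr; exact hA _
        _ ≤ Real.exp Δ * Real.exp (U - Δ) / ℓ := by gcongr
        _ = Real.exp U / ℓ := by rw [← Real.exp_add]; ring_nf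
    have hmain := norm_expEval_polyOfCoeffs_le_forms K t hr0 htX' hB hz
    rw [expEval_apply] at hmain
    refine hmain.trans ?_
    -- numerics: `K e^U/ℓ ≤ ½ e^{-U}` and `X e^{-K}/(1-e^{-1}) e^{U-Δ} ≤ ½ e^{-U}`
    have he1 : 0 < 1 - Real.exp (-1) := by
      have := Real.exp_lt_one_iff.2 (show (-1 : ℝ) < 0 by norm_num); linarith
    have hhead : (K : ℝ) * (Real.exp U / ℓ) ≤ Real.exp (-U) / 2 := by
      calc (K : ℝ) * (Real.exp U / ℓ) ≤ K * (Real.exp U / (2 * K * Real.exp (2 * U))) := by gcongr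
        _ = Real.exp (-U) / 2 := by
            have h2U : Real.exp (2 * U) = Real.exp U * Real.exp U := by
              rw [← Real.exp_add]; ring_nf
            rw [h2U, Real.exp_neg]; field_simp
    have htail : (X : ℝ) * (Real.exp (-(K : ℝ)) / (1 - Real.exp (-1))) *
        ∑ i : Fin (a + 1) × Fin (b + 1),
          (Real.exp 1 * r) ^ (i.1 : ℕ) * Real.exp ((i.2 : ℕ) * (Real.exp 1 * r)) ≤
        Real.exp (-U) / 2 := by
      calc (X : ℝ) * (Real.exp (-(K : ℝ)) / (1 - Real.exp (-1))) *
            ∑ i : Fin (a + 1) × Fin (b + 1),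
              (Real.exp 1 * r) ^ (i.1 : ℕ) * Real.exp ((i.2 : ℕ) * (Real.exp 1 * r))
          ≤ Real.exp Δ * (Real.exp (-(K : ℝ)) / (1 - Real.exp (-1))) * Real.exp (U - Δ) := by
            gcongr
        _ = Real.exp (U - K) / (1 - Real.exp (-1)) := by
            rw [show U - K = Δ + -(K : ℝ) + (U - Δ) by ring, Real.exp_add, Real.exp_add]; ring
        _ ≤ Real.exp (-U - 2) / (1 - Real.exp (-1)) :=
            div_le_div_of_nonneg_right (Real.exp_le_exp.2 (by linarith)) he1.le
        _ ≤ Real.exp (-U) / 2 := exp_neg_sub_two_div_le U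
    linarith

/-! ### Roy 2001, §5, 2° from the corrected Theorem 3 -/

/-- Roy 2001, §5, 2° (pp. 193–194) run from the **corrected** Theorem 3: with `α_j = e^{y_j}`,
`Roy2001_thm3'` applied with `Δ = N`, `r = 1 + cN^{s₁}` (`≥ 1 ≥ e⁻¹`), `T₀ = N^{t₀}`, `T₁ = N^{t₁}`,
`U = 2N^u`, `c = Σ|y_j|`, and Cauchy's inequalities produce the polynomials `P_N` of the
hypothesis of Conjecture 2 (same bookkeeping as `royHypothesis_exp`). [cite: Roy2001, §5 (2°)] -/
theorem royHypothesis_exp_of_thm3' (h₃ : Roy2001_thm3') {l : ℕ} (y : Fin l → ℂ)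
    {s₀ s₁ t₀ t₁ u : ℝ} (hadm : RoyAdmissible s₀ s₁ t₀ t₁ u) :
    RoyHypothesis y (cexp ∘ y) s₀ s₁ t₀ t₁ u := by
  set c : ℝ := ∑ j, ‖y j‖ with hc_def
  have hc : 0 ≤ c := Finset.sum_nonneg fun j _ => norm_nonneg _
  filter_upwards [eventually_roy_params hadm hc, eventually_gt_atTop 0] with N hN hN0
  obtain ⟨hU, hmain, hprod, hfact⟩ := hN
  have hNpos : (0 : ℝ) < N := by exact_mod_cast hN0
  have hr : Real.exp (-1) ≤ 1 + c * (N : ℝ) ^ s₁ := by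
    have h1 : Real.exp (-1) ≤ 1 := Real.exp_le_one_iff.2 (by norm_num)
    have h2 : 0 ≤ c * (N : ℝ) ^ s₁ := by positivity
    linarith
  obtain ⟨P, hP0, hd0, hd1, hH, hval⟩ := h₃ (N : ℝ) (1 + c * (N : ℝ) ^ s₁) ((N : ℝ) ^ t₀)
    ((N : ℝ) ^ t₁) (2 * (N : ℝ) ^ u) hNpos hr (Real.rpow_pos_of_pos hNpos _)
    (Real.rpow_pos_of_pos hNpos _) hU hmain hprod
  refine ⟨P, hP0, hd0, hd1, hH, fun k m hk hm => ?_⟩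
  set z₀ : ℂ := ∑ j, (m j : ℂ) * y j with hz₀_def
  have hz₀ : ‖z₀‖ ≤ c * (N : ℝ) ^ s₁ := by
    calc ‖z₀‖ ≤ ∑ j, ‖(m j : ℂ) * y j‖ := norm_sum_le _ _
      _ ≤ ∑ j, (N : ℝ) ^ s₁ * ‖y j‖ := by
          refine Finset.sum_le_sum fun j _ => ?_
          rw [norm_mul, Complex.norm_natCast]
          exact mul_le_mul_of_nonneg_right (hm j) (norm_nonneg _)
      _ = c * (N : ℝ) ^ s₁ := by rw [hc_def, Finset.sum_mul]; simp [mul_comm]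
  have hpt : (![∑ j, (m j : ℂ) * y j, ∏ j, (cexp ∘ y) j ^ m j] : Fin 2 → ℂ) = ![z₀, cexp z₀] := by
    have : ∏ j, (cexp ∘ y) j ^ m j = cexp z₀ := by
      rw [hz₀_def, Complex.exp_sum]
      simp [Complex.exp_nat_mul]
    rw [this]
  have hsphere : ∀ z ∈ sphere z₀ 1, ‖expEval P z‖ ≤ Real.exp (-(2 * (N : ℝ) ^ u)) := by
    intro z hz
    refine hval z ?_
    have h1 : ‖z - z₀‖ = 1 := by simpa [dist_eq_norm] using hz
    calc ‖z‖ = ‖(z - z₀) + z₀‖ := by ring_nf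
      _ ≤ ‖z - z₀‖ + ‖z₀‖ := norm_add_le _ _
      _ ≤ 1 + c * (N : ℝ) ^ s₁ := by rw [h1]; gcongr
  rw [hpt]
  calc ‖aeval ![z₀, cexp z₀] (royD^[k] P)‖ = ‖expEval (royD^[k] P) z₀‖ := rfl
    _ ≤ k.factorial * Real.exp (-(2 * (N : ℝ) ^ u)) :=
        norm_expEval_iterate_royD_le k P z₀ hsphere
    _ ≤ Real.exp (-(N : ℝ) ^ u) := hfact k hk

end Literature.NumberTheory.Transcendental

end
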